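import Summits.CriticalPhenomena.PercolationContinuityZ3.Theorems.PercNearOneGluingNoHeavyPcintVdBEFibreFactor
import Summits.CriticalPhenomena.PercolationContinuityZ3.Theorems.PercNearOneGluingNoHeavyPcintVdBEAnalytic
import Summits.CriticalPhenomena.PercolationContinuityZ3.Theorems.PercNearOneGluingNoHeavyPcintVdBEPositions
import HarnessLib

/-!
# PCINT lane, king route, K1 step (3b): the objects of a step and their laws

Cell `prim-pcint`, seat `prim-pcint-1` (gen 10); memo `run/shared/lean/prim/pcint/KING-ROUTE.md` §K1 (3).

For a step context `X` (selected site `b₂`, examiner `c`; `…PcintVdBEFibreFactor.lean`): the offset `cp` of `c`, the three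
children offsets `δ j` and their optional sites `oc j` ("virtual children": every child of `b₂` is one of them,
`oc_cover`; none of them is `b₂`, `c` or a failed brother, `oc_not_W`), the payoff `K g u` as a function of the
resampled coordinates and its expression `K_eq_Gt` through the three reads, the `π_q`-side `E_eq`, and the law of the
reads `sum_reads_eq_cps` (`cpsG` of the table at every direction, absent directions swapped in).  The slot of an optional
brother site (`slotOf`) and its factor (`slot_cast`) prepare the regrouping of the brother conditions; the per-state
domination inequalities themselves are in `…PcintVdBEStepDomination.lean`.
-/

namespace Summit.CriticalPhenomena.PercolationContinuityZ3.Theorems.Pcint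

namespace VdBEMarkov

open Finset AdaptDom ClusterExpl VdBELocal Literature.Probability.LatticeModels

variable {Λ : Finset (Site 2)} {enc : ↥Λ → ℕ} {o : ↥Λ}

/-! ### Small helpers -/

/-- Indicator of a conjunction. -/
theorem ind_and (P Q : Prop) [Decidable P] [Decidable Q] :
    (if P ∧ Q then (1 : ℝ) else 0) = (if P then 1 else 0) * (if Q then 1 else 0) := by
  split_ifs <;> simp_all

/-- The normalisation of a slot factor: `10⁶` for `fail`, `1` otherwise. -/
noncomputable def normS : Slot → ℝ
  | .fail => 10 ^ 6
  | _ => 1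

/-- `normS` is positive. -/
theorem normS_pos (s : Slot) : 0 < normS s := by
  cases s <;> simp [normS]

/-- Unit offsets of `ℤ²` never differ by a unit offset (no triangles through the origin). -/
theorem sub_not_mem_nbrs0 {a b : Pos} (ha : a ∈ nbrs (0, 0)) (hb : b ∈ nbrs (0, 0)) : a - b ∉ nbrs (0, 0) := by
  simp only [nbrs, List.mem_cons, List.mem_nil_iff, or_false, zero_add, zero_sub] at ha hb ⊢
  rcases ha with rfl | rfl | rfl | rfl <;> rcases hb with rfl | rfl | rfl | rfl <;> decide

/-- `(0,0)` is not a unit offset. -/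
theorem zero_not_mem_nbrs0 : ((0 : ℤ), (0 : ℤ)) ∉ nbrs (0, 0) := by decide

/-- `pos x - pos x = (0, 0)`. -/
theorem pos_sub_self (x : Site 2) : pos x - pos x = (0, 0) := Prod.ext (sub_self _) (sub_self _)

namespace StepCtx

variable (X : StepCtx enc o)

/-! ### Offsets and virtual children -/

/-- The one-site weights: the pair-state prior at every site. -/
noncomputable def mPV (_X : StepCtx enc o) : ↥Λ → PState → ℝ := fun _ => mP

/-- The one-site weights are probabilities. -/
theorem mPV_sum (v : ↥Λ) : ∑ s, X.mPV v s = 1 := sum_mP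

/-- The offset of `c` from `b₂`. -/
def cp : Pos := pos X.c.1 - pos X.b₂.1

/-- `cp` is a unit offset. -/
theorem cp_mem : X.cp ∈ nbrs (0, 0) := sub_mem_nbrs0_of_adj X.adj_c_b₂.symm

/-- The children offsets (the non-`c` directions of `b₂`), in the table's order. -/
def chL : List Pos := (nbrs (0, 0)).filter fun a => a ≠ X.cp

/-- The `j`-th children offset (junk `(0,0)` for `j ≥ 3`). -/
def δ (j : ℕ) : Pos := X.chL.getD j (0, 0)

/-- The children offset list is `[δ 0, δ 1, δ 2]`. -/
theorem chL_eq : X.chL = [X.δ 0, X.δ 1, X.δ 2] := list_eq_three (children_spec X.cp_mem).1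

/-- Membership in the children offset list. -/
theorem mem_chL {ρ : Pos} : ρ ∈ X.chL ↔ ρ ∈ nbrs (0, 0) ∧ ρ ≠ X.cp := by
  unfold chL; rw [List.mem_filter]; simp

/-- The children offsets are unit offsets different from `cp`. -/
theorem δ_spec {j : ℕ} (hj : j < 3) : X.δ j ∈ nbrs (0, 0) ∧ X.δ j ≠ X.cp := by
  have h : X.δ j ∈ X.chL := by
    rw [X.chL_eq]; interval_cases j <;> simp
  exact X.mem_chL.1 h

/-- The children offsets are pairwise distinct. -/
theorem δ_ne : X.δ 0 ≠ X.δ 1 ∧ X.δ 0 ≠ X.δ 2 ∧ X.δ 1 ≠ X.δ 2 := by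
  have h : X.chL.Nodup := (children_spec X.cp_mem).2
  rw [X.chL_eq] at h
  exact ne_of_nodup_three h

/-- The optional site of `Λ` at the `j`-th children offset (a "virtual child"). -/
noncomputable def oc (j : ℕ) : Option ↥Λ := siteAt Λ (pos X.b₂.1 + X.δ j)

/-- The position of a virtual child. -/
theorem oc_pos {j : ℕ} {v : ↥Λ} (h : X.oc j = some v) : pos v.1 = pos X.b₂.1 + X.δ j := siteAt_eq_some_iff.1 h

/-- The virtual children are distinct. -/
theorem oc_distinct : (∀ v, X.oc 0 = some v → X.oc 1 ≠ some v) ∧ (∀ v, X.oc 0 = some v → X.oc 2 ≠ some v) ∧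
    (∀ v, X.oc 1 = some v → X.oc 2 ≠ some v) := by
  obtain ⟨h01, h02, h12⟩ := X.δ_ne
  refine ⟨fun v hv => siteAt_ne_of_ne ?_ v hv, fun v hv => siteAt_ne_of_ne ?_ v hv, fun v hv => siteAt_ne_of_ne ?_ v hv⟩
  · exact fun h => h01 (add_left_cancel h)
  · exact fun h => h02 (add_left_cancel h)
  · exact fun h => h12 (add_left_cancel h)

/-- **A virtual child is neither `b₂` nor `c` nor a failed brother.** -/
theorem oc_not_W {j : ℕ} (hj : j < 3) {v : ↥Λ} (h : X.oc j = some v) : v ≠ X.b₂ ∧ v ≠ X.c ∧ v ∉ X.Bf := by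
  have hp := X.oc_pos h
  obtain ⟨hδ, hδc⟩ := X.δ_spec hj
  refine ⟨fun hv => ?_, fun hv => ?_, fun hv => ?_⟩
  · rw [hv] at hp
    have : X.δ j = (0, 0) := by
      have := congrArg (· - pos X.b₂.1) hp; simp only [add_sub_cancel_left, pos_sub_self] at this; exact this.symm
    exact zero_not_mem_nbrs0 (this ▸ hδ)
  · rw [hv] at hp
    apply hδc
    have := congrArg (· - pos X.b₂.1) hp; simp only [add_sub_cancel_left] at this
    exact this.symm
  · have hB := (X.mem_Bf hv).1
    have h1 := sub_mem_nbrs0_of_adj (X.mem_B hB).2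
    rw [hp] at h1
    have : pos X.b₂.1 + X.δ j - pos X.c.1 = X.δ j - X.cp := by simp only [cp]; abel
    rw [this] at h1
    exact sub_not_mem_nbrs0 hδ X.cp_mem h1

/-- The `hoW` hypothesis of `AdaptDom.inner_sum_eq` for the virtual children. -/
theorem oc_hoW (v : ↥Λ) (hv : X.oc 0 = some v ∨ X.oc 1 = some v ∨ X.oc 2 = some v) :
    v ≠ X.b₂ ∧ v ≠ X.c ∧ v ∉ X.Bf := by
  rcases hv with h | h | h
  · exact X.oc_not_W (by norm_num) h
  · exact X.oc_not_W (by norm_num) h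
  · exact X.oc_not_W (by norm_num) h

/-- **Every child is a virtual child.** -/
theorem oc_cover {a : ↥Λ} (ha : a ∈ X.C) : X.oc 0 = some a ∨ X.oc 1 = some a ∨ X.oc 2 = some a := by
  have hρ : pos a.1 - pos X.b₂.1 ∈ X.chL := by
    rw [X.mem_chL]
    refine ⟨sub_mem_nbrs0_of_adj (X.mem_C ha).2, fun h => (X.mem_C_ne ha).2.1 ?_⟩
    exact Subtype.ext (pos_injective (sub_left_injective h))
  rw [X.chL_eq] at hρ
  simp only [List.mem_cons, List.mem_nil_iff, or_false] at hρ
  have key : ∀ j, pos a.1 - pos X.b₂.1 = X.δ j → X.oc j = some a := fun j hj => by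
    unfold oc; rw [← hj, add_sub_cancel]; exact siteAt_pos a
  rcases hρ with h | h | h
  · exact Or.inl (key 0 h)
  · exact Or.inr (Or.inl (key 1 h))
  · exact Or.inr (Or.inr (key 2 h))

/-! ### The payoff through the reads; the `π_q`-side -/

/-- The payoff as a function of the resampled coordinates: `g` of the children outcomes `η(a, b₂)(u a, u b₂)`. -/
noncomputable def K (g : (↥Λ → Bool) → ℝ) (u : ↥Λ → PState) : ℝ :=
  g fun v => if v ∈ X.C then etaB v.1 X.b₂.1 (u v) (u X.b₂) else false

/-- The read maps of the virtual children, given the state `α` of `b₂`. -/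
def φ (α : PState) : ↥Λ → PState → Bool := fun v s => etaB v.1 X.b₂.1 s α

/-- The test function on the three children outcomes. -/
noncomputable def Gt (g : (↥Λ → Bool) → ℝ) (y0 y1 y2 : Bool) : ℝ := g (xOf (X.oc 0) (X.oc 1) (X.oc 2) y0 y1 y2)

/-- **The payoff is the test function of the three reads.** -/
theorem K_eq_Gt {g : (↥Λ → Bool) → ℝ} (hg : StepTest X.C g) (u : ↥Λ → PState) :
    X.K g u = X.Gt g (readB (X.φ (u X.b₂)) (X.oc 0) u) (readB (X.φ (u X.b₂)) (X.oc 1) u)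
      (readB (X.φ (u X.b₂)) (X.oc 2) u) := by
  obtain ⟨h01, h02, h12⟩ := X.oc_distinct
  unfold K Gt
  refine hg.2 _ _ fun v hv => ?_
  rw [if_pos hv, xOf_apply_of_reads h01 h02 h12 (X.φ (u X.b₂)) u (X.oc_cover hv)]
  rfl

/-- **The `π_q`-side**: `E_{π_q}[g] = Σ_y π_q^{⊗3}(y) · Gt y`. -/
theorem E_eq {g : (↥Λ → Bool) → ℝ} (hg : StepTest X.C g) :
    ∑ ω : ↥Λ → Bool, wt (556 / 1000) ω * g ω = ∑ y : Bool × Bool × Bool, pi3 y * X.Gt g y.1 y.2.1 y.2.2 := by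
  obtain ⟨h01, h02, h12⟩ := X.oc_distinct
  exact sum_wt_eq_sum_pi3 hg _ _ _ h01 h02 h12 fun v hv => X.oc_cover hv

/-- The semantic child probabilities of the three directions. -/
noncomputable def cps (j : ℕ) (α : PState) (b : Bool) : ℝ := cpsG (X.δ j) (0, 0) α b

/-- The law of a present virtual child is `cps`. -/
theorem lawB_oc_eq {j : ℕ} {a : ↥Λ} (h : X.oc j = some a) (α : PState) :
    lawB X.mPV (X.φ α) (X.oc j) = X.cps j α := by
  funext b
  rw [h]
  have := lawB_eq_cpsG a X.b₂ (pos X.b₂.1) α b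
  rw [X.oc_pos h, add_sub_cancel_left, pos_sub_self] at this
  exact this

/-- **The law of the three reads is the table's**: absent directions are swapped in (the test function ignores them). -/
theorem sum_reads_eq_cps (g : (↥Λ → Bool) → ℝ) (α : PState) :
    ∑ y0, ∑ y1, ∑ y2, lawB X.mPV (X.φ α) (X.oc 0) y0 * lawB X.mPV (X.φ α) (X.oc 1) y1 *
        lawB X.mPV (X.φ α) (X.oc 2) y2 * X.Gt g y0 y1 y2 =
      ∑ y0, ∑ y1, ∑ y2, X.cps 0 α y0 * X.cps 1 α y1 * X.cps 2 α y2 * X.Gt g y0 y1 y2 := by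
  have hl : ∀ j, ∑ b, lawB X.mPV (X.φ α) (X.oc j) b = 1 := fun j => sum_lawB _ X.mPV_sum _ _
  have hc : ∀ j, ∑ b, X.cps j α b = 1 := fun j => sum_cpsG _ _ _
  have e0 : ∑ y0, ∑ y1, ∑ y2, lawB X.mPV (X.φ α) (X.oc 0) y0 * lawB X.mPV (X.φ α) (X.oc 1) y1 *
        lawB X.mPV (X.φ α) (X.oc 2) y2 * X.Gt g y0 y1 y2 =
      ∑ y0, ∑ y1, ∑ y2, X.cps 0 α y0 * lawB X.mPV (X.φ α) (X.oc 1) y1 *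
        lawB X.mPV (X.φ α) (X.oc 2) y2 * X.Gt g y0 y1 y2 := by
    cases h : X.oc 0 with
    | none =>
      have h1 : ∑ b, lawB X.mPV (X.φ α) none b = 1 := by have := hl 0; rwa [h] at this
      have hG : ∀ y1 y2, X.Gt g true y1 y2 = X.Gt g false y1 y2 := fun y1 y2 => by
        simp only [Gt]; rw [xOf_congr₀ h true false y1 y2]
      exact sum_law3_congr_fst _ _ _ _ h1 (hc 0) _ hG
    | some a => rw [← h, X.lawB_oc_eq h]
  have e1 : ∑ y0, ∑ y1, ∑ y2, X.cps 0 α y0 * lawB X.mPV (X.φ α) (X.oc 1) y1 *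
        lawB X.mPV (X.φ α) (X.oc 2) y2 * X.Gt g y0 y1 y2 =
      ∑ y0, ∑ y1, ∑ y2, X.cps 0 α y0 * X.cps 1 α y1 * lawB X.mPV (X.φ α) (X.oc 2) y2 * X.Gt g y0 y1 y2 := by
    cases h : X.oc 1 with
    | none =>
      have h1 : ∑ b, lawB X.mPV (X.φ α) none b = 1 := by have := hl 1; rwa [h] at this
      have hG : ∀ y0 y2, X.Gt g y0 true y2 = X.Gt g y0 false y2 := fun y0 y2 => by
        simp only [Gt]; rw [xOf_congr₁ h y0 true false y2]
      exact sum_law3_congr_snd _ _ _ _ h1 (hc 1) _ hG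
    | some a => rw [← h, X.lawB_oc_eq h]
  have e2 : ∑ y0, ∑ y1, ∑ y2, X.cps 0 α y0 * X.cps 1 α y1 * lawB X.mPV (X.φ α) (X.oc 2) y2 * X.Gt g y0 y1 y2 =
      ∑ y0, ∑ y1, ∑ y2, X.cps 0 α y0 * X.cps 1 α y1 * X.cps 2 α y2 * X.Gt g y0 y1 y2 := by
    cases h : X.oc 2 with
    | none =>
      have h1 : ∑ b, lawB X.mPV (X.φ α) none b = 1 := by have := hl 2; rwa [h] at this
      have hG : ∀ y0 y1, X.Gt g y0 y1 true = X.Gt g y0 y1 false := fun y0 y1 => by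
        simp only [Gt]; rw [xOf_congr₂ h y0 y1 true false]
      exact sum_law3_congr_thd _ _ _ _ h1 (hc 2) _ hG
    | some a => rw [← h, X.lawB_oc_eq h]
  rw [e0, e1, e2]

/-- The product of the three children laws has total mass `1`. -/
theorem sum_cps_prod (α : PState) :
    ∑ y : Bool × Bool × Bool, X.cps 0 α y.1 * X.cps 1 α y.2.1 * X.cps 2 α y.2.2 = 1 := by
  have hc : ∀ j, ∑ b, X.cps j α b = 1 := fun j => sum_cpsG _ _ _
  rw [Fintype.sum_prod_type]
  simp_rw [Fintype.sum_prod_type]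
  have : ∀ y0 y1 : Bool, ∑ y2, X.cps 0 α y0 * X.cps 1 α y1 * X.cps 2 α y2 = X.cps 0 α y0 * X.cps 1 α y1 := by
    intro y0 y1; rw [← Finset.mul_sum, hc 2, mul_one]
  simp_rw [this]
  have : ∀ y0 : Bool, ∑ y1, X.cps 0 α y0 * X.cps 1 α y1 = X.cps 0 α y0 := by
    intro y0; rw [← Finset.mul_sum, hc 1, mul_one]
  simp_rw [this]
  exact hc 0

/-- The product of the three read laws has total mass `1`. -/
theorem sum_lawB_prod (α : PState) :
    ∑ y0, ∑ y1, ∑ y2, lawB X.mPV (X.φ α) (X.oc 0) y0 * lawB X.mPV (X.φ α) (X.oc 1) y1 *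
      lawB X.mPV (X.φ α) (X.oc 2) y2 = 1 := by
  have hl : ∀ j, ∑ b, lawB X.mPV (X.φ α) (X.oc j) b = 1 := fun j => sum_lawB _ X.mPV_sum _ _
  have : ∀ y0 y1 : Bool, ∑ y2, lawB X.mPV (X.φ α) (X.oc 0) y0 * lawB X.mPV (X.φ α) (X.oc 1) y1 *
      lawB X.mPV (X.φ α) (X.oc 2) y2 = lawB X.mPV (X.φ α) (X.oc 0) y0 * lawB X.mPV (X.φ α) (X.oc 1) y1 := by
    intro y0 y1; rw [← Finset.mul_sum, hl 2, mul_one]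
  simp_rw [this]
  have : ∀ y0 : Bool, ∑ y1, lawB X.mPV (X.φ α) (X.oc 0) y0 * lawB X.mPV (X.φ α) (X.oc 1) y1 =
      lawB X.mPV (X.φ α) (X.oc 0) y0 := by
    intro y0; rw [← Finset.mul_sum, hl 1, mul_one]
  simp_rw [this]
  exact hl 0

/-! ### Brother slots -/

/-- The slot of an optional brother site: `absent` unless it is a site examined by `c`; then `fail` if revealed false,
`succ (w b)` otherwise. -/
noncomputable def slotOf (w : ↥Λ → PState) : Option ↥Λ → Slot
  | none => Slot.absent
  | some b => if b ∈ X.B then (if X.σ b = some false then Slot.fail else Slot.succ (w b)) else Slot.absent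

/-- The failed-brother factor `[η(b, c)(β, γ) = 0]`. -/
noncomputable def Fb (b : ↥Λ) (β γ : PState) : ℝ := if etaB b.1 X.c.1 β γ = false then 1 else 0

/-- The integrated failed-brother factor `Σ_β mP β · [η(b, c)(β, γ) = 0]`. -/
noncomputable def fb (γ : PState) (b : ↥Λ) : ℝ := ∑ β, mP β * X.Fb b β γ

/-- The successful brothers other than `b₂`. -/
noncomputable def Bs : Finset ↥Λ := X.B.filter fun b => b ≠ X.b₂ ∧ X.σ b = some true

/-- The successful-brother indicator of an optional brother site. -/
noncomputable def optP (w : ↥Λ → PState) (γ : PState) (ob : Option ↥Λ) : ℝ :=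
  if (∀ b, ob = some b → b ∈ X.Bs → etaB b.1 X.c.1 (w b) γ = true) then 1 else 0

/-- A site of `B` is revealed true or revealed false. -/
theorem σ_true_of_mem_B {b : ↥Λ} (hB : b ∈ X.B) (hf : X.σ b ≠ some false) : X.σ b = some true := by
  have h := X.σ_of_mem_B hB
  cases hv : readOut X.σ (traj enc o X.σ X.k₀) b with
  | false => rw [hv] at h; exact absurd h hf
  | true => rw [hv] at h; exact h

/-- **The slot factor of the table at a brother position, regrouped**: for an optional brother site `ob` at relative
position `π` and `c` at relative position `c'` (positions relative to a reference point `t`), the table's slot factor is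
the normalisation times the failed-brother factor times the successful-brother indicator. -/
theorem slot_cast (w : ↥Λ → PState) (γ : PState) {ob : Option ↥Λ} {c' π t : Pos} (hc' : pos X.c.1 - t = c')
    (hpos : ∀ b, ob = some b → pos b.1 - t = π) (hb₂ : ∀ b, ob = some b → b ≠ X.b₂) :
    (slotFactor c' π γ (X.slotOf w ob) : ℝ) =
      normS (X.slotOf w ob) * (optF ob X.Bf (X.fb γ) * X.optP w γ ob) := by
  cases ob with
  | none =>
    simp only [slotOf, normS, optF, optP, slotFactor_absent_cast]
    simp
  | some b =>
    have hp := hpos b rfl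
    have hbb₂ : b ≠ X.b₂ := hb₂ b rfl
    by_cases hB : b ∈ X.B
    · have he : ∀ β, eta c' π γ β = etaB b.1 X.c.1 β γ := fun β => by
        rw [etaB_comm (sum_ne_of_adj (X.mem_B hB).2).symm, etaB_eq_eta_sub X.c.1 b.1 t, hc', hp]
      by_cases hf : X.σ b = some false
      · -- failed brother
        have hBf : b ∈ X.Bf := mem_filter.2 ⟨hB, hf⟩
        have hBs : b ∉ X.Bs := fun h => by have := (mem_filter.1 h).2.2; rw [hf] at this; exact absurd this (by simp)
        simp only [slotOf, hB, hf, if_true, normS, optF, hBf, optP]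
        rw [slotFactor_fail_cast, if_pos (fun b' hb' hBs' => by cases hb'; exact absurd hBs' hBs), mul_one]
        congr 1
        unfold fb Fb
        refine Finset.sum_congr rfl fun β _ => ?_
        rw [he β]; cases etaB b.1 X.c.1 β γ <;> simp
      · -- successful brother
        have ht : X.σ b = some true := X.σ_true_of_mem_B hB hf
        have hBf : b ∉ X.Bf := fun h => hf (mem_filter.1 h).2
        have hBs : b ∈ X.Bs := mem_filter.2 ⟨hB, hbb₂, ht⟩
        simp only [slotOf, hB, hf, if_true, if_false, normS, optF, hBf, optP, one_mul]
        rw [slotFactor_succ_cast, he (w b)]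
        by_cases hP : etaB b.1 X.c.1 (w b) γ = true
        · rw [if_pos hP, if_pos (fun b' hb' _ => by cases hb'; exact hP)]
        · rw [if_neg hP, if_neg (fun h => hP (h b rfl hBs))]
    · -- not examined by `c`
      have hBf : b ∉ X.Bf := fun h => hB (X.mem_Bf h).1
      have hBs : b ∉ X.Bs := fun h => hB (mem_filter.1 h).1
      simp only [slotOf, hB, if_false, normS, optF, hBf, optP, slotFactor_absent_cast]
      rw [if_pos (fun b' hb' hBs' => by cases hb'; exact absurd hBs' hBs)]; ring

end StepCtx

end VdBEMarkov

end Summit.CriticalPhenomena.PercolationContinuityZ3.Theorems.Pcint
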